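import Literature.InformationTheory.QuantumCodes.QuantumExpanderCodes
import Literature.Combinatorics.Expanders.BoundedConcentrator
import Mathlib.Data.Fintype.BigOperators
import Mathlib.Data.Fintype.Perm
import HarnessLib

/-!
# Random lifts of a complete bipartite graph: the model and the single-set expansion-failure count

Venture QEC (`Summits/Ventures/QEC`), item 04.EXIST (existence of exactly-biregular two-sided lossless
expanders of every size, for the quantum-expander threshold theorems of
`Literature/InformationTheory/QuantumCodes/QuantumExpander*`). This file: the MODEL and MILESTONE M1.

An `n`-lift of the complete bipartite graph `K_{Δ_B, Δ_A}`: left vertices `A = Fin Δ_B × Fin n`, right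
vertices `B = Fin Δ_A × Fin n`, one permutation `π_{l,r} ∈ Perm(Fin n)` for every base edge `(l, r)`, and the
edge `(l,i) ∼ (r, π_{l,r}(i))`. Its biadjacency matrix `liftMatrix π : Matrix B A (ZMod 2)` is EXACTLY
`(Δ_A, Δ_B)`-biregular for every configuration `π` (`isBiregular_liftMatrix`) — the point of the model: no
multi-edges, unlike the configuration model of Sipser–Spielman 1996 / Richardson–Urbanke 2008 Thm 8.7 /
FGL18 Thm 4.

Single-set count (first moment, M1): for fixed `S ⊆ A` and `T ⊆ B`, the configurations whose neighbourhood
`Γ_π(S)` lies inside `T` form a PRODUCT set over the base edges (`π_{l,r}` must map the fibre `S_l` into the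
fibre `T_r`), so their number is `Π_{l,r} #{π : π(S_l) ⊆ T_r} ≤ Π_{l,r} n!·(|T_r|/n)^{|S_l|} ≤ |Ω|·(|T|/n)^{Δ_A|S|}`
(`card_nbhdWithin_le`: `#{π : Γ_π(S) ⊆ T}·n^{Δ_A|S|} ≤ |Ω|·|T|^{Δ_A|S|}`, using the tree's permutation count
`card_perm_mapsTo_mul_choose` and `choose_mul_pow_le_choose_mul_pow`); hence the configurations in which `S`
FAILS `(γ,δ)`-expansion (`|Γ_π(S)| < (1-δ)Δ_A|S|`) number at most `|Ω|·Σ_{m<(1-δ)Δ_A|S|} C(n_B, m)(m/n)^{Δ_A|S|}`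
(`card_expansionFails_le`). All statements PROVED; no named facts. Our own elementary argument
(probabilistic method); the union bound over `S` and the choice of `γ` are in the companion files
`BiregularExpanderEstimates` / `BiregularExpanderExistence`.

Sources (context, not formalised): random lifts (coverings) of a base graph — Amit–Linial, "Random graph
coverings I", Combinatorica 22 (2002), and the protograph-LDPC literature; vertex ("lossless") expansion of
random sparse bipartite graphs by the first-moment method — Bassalygo 1981, Sipser–Spielman 1996 (expander codes),
Richardson–Urbanke 2008 Thm 8.7, quoted as FGL18 Thm 4 and in LTZ15 after Thm 2 (all for the configuration
model / degrees `≤ Δ`); the permutation count is Bürgisser–Clausen–Shokrollahi 1997 Lemma (13.32) as formalised in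
`Literature/Combinatorics/Expanders/BoundedConcentrator.lean`.
-/

namespace Summit.Ventures.QEC.Expanders

open Finset Literature.InformationTheory.QuantumCodes Literature.Combinatorics.Expanders

/-! ### The lift model -/

section Model

variable {dA dB n : ℕ}

/-- A configuration of an `n`-lift of `K_{Δ_B,Δ_A}`: one permutation of `Fin n` per base edge `(l, r)`.
[folklore] -/
abbrev LiftConfig (dA dB n : ℕ) : Type := Fin dB → Fin dA → Equiv.Perm (Fin n)

/-- The biadjacency matrix of the lift: right vertex `(r, j)` is adjacent to left vertex `(l, i)` iff
`π_{l,r}(i) = j`. [folklore] -/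
def liftMatrix (σ : LiftConfig dA dB n) : Matrix (Fin dA × Fin n) (Fin dB × Fin n) (ZMod 2) :=
  fun b a => if σ a.1 b.1 a.2 = b.2 then 1 else 0

/-- Entries of the lift matrix are nonzero exactly on the edges. [folklore] -/
theorem liftMatrix_ne_zero_iff (σ : LiftConfig dA dB n) (b : Fin dA × Fin n) (a : Fin dB × Fin n) :
    liftMatrix σ b a ≠ 0 ↔ σ a.1 b.1 a.2 = b.2 := by
  unfold liftMatrix
  by_cases h : σ a.1 b.1 a.2 = b.2 <;> simp [h]

/-- **Every lift is exactly `(Δ_A, Δ_B)`-biregular**: the column `(l,i)` has the `Δ_A` entries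
`(r, π_{l,r} i)`, the row `(r,j)` the `Δ_B` entries `(l, π_{l,r}⁻¹ j)`. [folklore] -/
theorem isBiregular_liftMatrix (σ : LiftConfig dA dB n) : IsBiregular (liftMatrix σ) dA dB := by
  classical
  constructor
  · intro a
    have hset : (univ.filter fun b : Fin dA × Fin n => liftMatrix σ b a ≠ 0)
        = (univ : Finset (Fin dA)).image fun r => (r, σ a.1 r a.2) := by
      ext ⟨r, j⟩
      simp only [Finset.mem_filter, Finset.mem_univ, true_and, Finset.mem_image, liftMatrix_ne_zero_iff,
        Prod.mk.injEq]
      constructor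
      · intro h; exact ⟨r, rfl, h⟩
      · rintro ⟨r', rfl, h⟩; exact h
    rw [hset, Finset.card_image_of_injective _ (fun r r' h => (Prod.mk.inj h).1), Finset.card_univ,
      Fintype.card_fin]
  · intro b
    have hset : (univ.filter fun a : Fin dB × Fin n => liftMatrix σ b a ≠ 0)
        = (univ : Finset (Fin dB)).image fun l => (l, (σ l b.1).symm b.2) := by
      ext ⟨l, i⟩
      simp only [Finset.mem_filter, Finset.mem_univ, true_and, Finset.mem_image, liftMatrix_ne_zero_iff,
        Prod.mk.injEq]
      constructor
      · intro h; exact ⟨l, rfl, by rw [← h, Equiv.symm_apply_apply]⟩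
      · rintro ⟨l', rfl, h⟩; rw [← h, Equiv.apply_symm_apply]
    rw [hset, Finset.card_image_of_injective _ (fun l l' h => (Prod.mk.inj h).1), Finset.card_univ,
      Fintype.card_fin]

/-- The neighbourhood of `S` in the lift: `(r, j) ∈ Γ(S)` iff `j = π_{l,r}(i)` for some `(l,i) ∈ S`.
[folklore] -/
theorem mem_leftNbhd_liftMatrix (σ : LiftConfig dA dB n) (S : Finset (Fin dB × Fin n)) (b : Fin dA × Fin n) :
    b ∈ leftNbhd (liftMatrix σ) S ↔ ∃ a ∈ S, σ a.1 b.1 a.2 = b.2 := by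
  simp only [leftNbhd, Finset.mem_filter, Finset.mem_univ, true_and, liftMatrix_ne_zero_iff]

/-- `Γ(S) ⊆ T` iff every edge out of `S` lands in `T`. [folklore] -/
theorem leftNbhd_liftMatrix_subset_iff (σ : LiftConfig dA dB n) (S : Finset (Fin dB × Fin n))
    (T : Finset (Fin dA × Fin n)) :
    leftNbhd (liftMatrix σ) S ⊆ T ↔ ∀ a ∈ S, ∀ r : Fin dA, (r, σ a.1 r a.2) ∈ T := by
  constructor
  · intro h a ha r
    exact h ((mem_leftNbhd_liftMatrix σ S (r, σ a.1 r a.2)).2 ⟨a, ha, rfl⟩)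
  · intro h b hb
    obtain ⟨a, ha, hab⟩ := (mem_leftNbhd_liftMatrix σ S b).1 hb
    have := h a ha b.1
    rwa [hab] at this

end Model

/-! ### The single-set count (milestone M1) -/

section SingleSet

variable {dA dB n : ℕ}

/-- The fibre `S_l = {i : (l,i) ∈ S}` of a set of left vertices over the base vertex `l`. [folklore] -/
def fiberL (S : Finset (Fin dB × Fin n)) (l : Fin dB) : Finset (Fin n) :=
  univ.filter fun i => (l, i) ∈ S

/-- The fibre `T_r = {j : (r,j) ∈ T}` of a set of right vertices over the base vertex `r`. [folklore] -/
def fiberR (T : Finset (Fin dA × Fin n)) (r : Fin dA) : Finset (Fin n) :=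
  univ.filter fun j => (r, j) ∈ T

/-- The sizes of the left fibres add up to `|S|`. [folklore] -/
theorem sum_card_fiberL (S : Finset (Fin dB × Fin n)) : ∑ l, (fiberL S l).card = S.card := by
  classical
  rw [Finset.card_eq_sum_card_fiberwise (f := fun a : Fin dB × Fin n => a.1) (t := univ)
    (fun a _ => Finset.mem_coe.2 (Finset.mem_univ _))]
  refine Finset.sum_congr rfl fun l _ => ?_
  rw [fiberL]
  refine Finset.card_bij (fun i _ => (l, i)) ?_ ?_ ?_
  · intro i hi
    rw [Finset.mem_filter] at hi ⊢
    exact ⟨hi.2, rfl⟩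
  · intro i _ i' _ h
    exact (Prod.mk.inj h).2
  · rintro ⟨l', i⟩ ha
    rw [Finset.mem_filter] at ha
    obtain ⟨hS, rfl⟩ := ha
    exact ⟨i, Finset.mem_filter.2 ⟨Finset.mem_univ _, hS⟩, rfl⟩

/-- A right fibre is no larger than the set. [folklore] -/
theorem card_fiberR_le (T : Finset (Fin dA × Fin n)) (r : Fin dA) : (fiberR T r).card ≤ T.card := by
  rw [fiberR]
  refine Finset.card_le_card_of_injOn (fun j => (r, j)) ?_ ?_
  · intro j hj
    rw [Finset.mem_coe, Finset.mem_filter] at hj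
    exact hj.2
  · intro j _ j' _ h
    exact (Prod.mk.inj h).2

/-- The configurations with `Γ(S) ⊆ T` are the product, over the base edges, of the sets of permutations
mapping the fibre `S_l` into the fibre `T_r`. [folklore] -/
theorem filter_nbhd_subset_eq_piFinset (S : Finset (Fin dB × Fin n)) (T : Finset (Fin dA × Fin n)) :
    (univ.filter fun σ : LiftConfig dA dB n => leftNbhd (liftMatrix σ) S ⊆ T)
      = Fintype.piFinset fun l => Fintype.piFinset fun r =>
          univ.filter fun π : Equiv.Perm (Fin n) => ∀ i ∈ fiberL S l, π i ∈ fiberR T r := by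
  ext σ
  simp only [Finset.mem_filter, Finset.mem_univ, true_and, Fintype.mem_piFinset, fiberL, fiberR,
    leftNbhd_liftMatrix_subset_iff]
  constructor
  · intro h l r i hi
    exact h (l, i) hi r
  · rintro h ⟨l, i⟩ ha r
    exact h l r i ha

/-- The permutations of `Fin n` mapping `S'` into `T'`: `#{π : π(S') ⊆ T'}·n^{|S'|} ≤ |T'|^{|S'|}·n!`
(`#{π : π(S') ⊆ T'} = n!·C(|T'|,|S'|)/C(n,|S'|)` and `C(t,s)/C(n,s) ≤ (t/n)^s`).
[cite: BurgisserClausenShokrollahi1997, Lemma (13.32) (proof, PDF p. 357)] -/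
theorem card_perm_mapsTo_mul_pow_le (S' T' : Finset (Fin n)) :
    (univ.filter fun π : Equiv.Perm (Fin n) => ∀ i ∈ S', π i ∈ T').card * n ^ S'.card
      ≤ T'.card ^ S'.card * n.factorial := by
  classical
  have h1 : (univ.filter fun π : Equiv.Perm (Fin n) => ∀ i ∈ S', π i ∈ T').card * n.choose S'.card
      = T'.card.choose S'.card * n.factorial := by
    have h := card_perm_mapsTo_mul_choose S' T'
    rw [Fintype.card_fin] at h
    convert h using 3
    ext π
    simp
  have h2 := choose_mul_pow_le_choose_mul_pow (T'.card_le_univ.trans_eq (Fintype.card_fin n)) S'.card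
  -- `#Q·C(n,s)·n^s = C(t,s)·n!·n^s ≤ C(n,s)·t^s·n!`, then cancel `C(n,s) > 0`
  have hpos : 0 < n.choose S'.card :=
    Nat.choose_pos (S'.card_le_univ.trans_eq (Fintype.card_fin n))
  refine Nat.le_of_mul_le_mul_left ?_ hpos
  calc n.choose S'.card * ((univ.filter fun π : Equiv.Perm (Fin n) => ∀ i ∈ S', π i ∈ T').card * n ^ S'.card)
      = ((univ.filter fun π : Equiv.Perm (Fin n) => ∀ i ∈ S', π i ∈ T').card * n.choose S'.card)
          * n ^ S'.card := by ring
    _ = T'.card.choose S'.card * n.factorial * n ^ S'.card := by rw [h1]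
    _ = (T'.card.choose S'.card * n ^ S'.card) * n.factorial := by ring
    _ ≤ (n.choose S'.card * T'.card ^ S'.card) * n.factorial := Nat.mul_le_mul_right _ h2
    _ = n.choose S'.card * (T'.card ^ S'.card * n.factorial) := by ring

/-- The number of configurations. [folklore] -/
theorem card_liftConfig : Fintype.card (LiftConfig dA dB n) = (n.factorial ^ dA) ^ dB := by
  simp [LiftConfig, Fintype.card_pi, Fintype.card_perm, Fintype.card_fin, Finset.prod_const,
    Finset.card_univ]

/-- **M1 — the single-set containment count**: for fixed `S ⊆ A` and `T ⊆ B`,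
`#{π : Γ_π(S) ⊆ T}·n^{Δ_A|S|} ≤ |Ω|·|T|^{Δ_A|S|}` — i.e. a uniformly random lift has `Γ(S) ⊆ T` with
probability `≤ (|T|/n)^{Δ_A|S|}` (product over the base edges of `(|T_r|/n)^{|S_l|}`, and `|T_r| ≤ |T|`,
`Σ_l |S_l| = |S|`). [folklore] -/
theorem card_nbhdWithin_le (S : Finset (Fin dB × Fin n)) (T : Finset (Fin dA × Fin n)) :
    (univ.filter fun σ : LiftConfig dA dB n => leftNbhd (liftMatrix σ) S ⊆ T).card * n ^ (dA * S.card)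
      ≤ Fintype.card (LiftConfig dA dB n) * T.card ^ (dA * S.card) := by
  classical
  rw [filter_nbhd_subset_eq_piFinset, Fintype.card_piFinset, card_liftConfig]
  simp only [Fintype.card_piFinset]
  -- per base edge
  have hedge : ∀ (l : Fin dB) (r : Fin dA),
      (univ.filter fun π : Equiv.Perm (Fin n) => ∀ i ∈ fiberL S l, π i ∈ fiberR T r).card
          * n ^ (fiberL S l).card
        ≤ T.card ^ (fiberL S l).card * n.factorial := by
    intro l r
    refine (card_perm_mapsTo_mul_pow_le (fiberL S l) (fiberR T r)).trans ?_
    exact Nat.mul_le_mul_right _ (Nat.pow_le_pow_left (card_fiberR_le T r) _)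
  -- product over `r` for a fixed `l`
  have hrow : ∀ l : Fin dB,
      (∏ r : Fin dA, (univ.filter fun π : Equiv.Perm (Fin n) => ∀ i ∈ fiberL S l, π i ∈ fiberR T r).card)
          * n ^ (dA * (fiberL S l).card)
        ≤ (T.card ^ (fiberL S l).card * n.factorial) ^ dA := by
    intro l
    have h := Finset.prod_le_prod' (s := (univ : Finset (Fin dA)))
      (f := fun r => (univ.filter fun π : Equiv.Perm (Fin n) =>
        ∀ i ∈ fiberL S l, π i ∈ fiberR T r).card * n ^ (fiberL S l).card)
      (g := fun _ => T.card ^ (fiberL S l).card * n.factorial) (fun r _ => hedge l r)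
    rw [Finset.prod_mul_distrib, Finset.prod_const, Finset.prod_const, Finset.card_univ, Fintype.card_fin,
      ← pow_mul, mul_comm (fiberL S l).card] at h
    exact h
  -- product over `l`
  have hall := Finset.prod_le_prod' (s := (univ : Finset (Fin dB)))
    (f := fun l => (∏ r : Fin dA, (univ.filter fun π : Equiv.Perm (Fin n) =>
        ∀ i ∈ fiberL S l, π i ∈ fiberR T r).card) * n ^ (dA * (fiberL S l).card))
    (g := fun l => (T.card ^ (fiberL S l).card * n.factorial) ^ dA) (fun l _ => hrow l)
  rw [Finset.prod_mul_distrib] at hall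
  -- rewrite the exponents: `Π_l n^{dA |S_l|} = n^{dA |S|}` and `Π_l (t^{|S_l|} n!)^{dA} = (n!^{dA})^{dB} t^{dA|S|}`
  have hexp1 : (∏ l : Fin dB, n ^ (dA * (fiberL S l).card)) = n ^ (dA * S.card) := by
    rw [Finset.prod_pow_eq_pow_sum, ← Finset.mul_sum, sum_card_fiberL]
  have hexp2 : (∏ l : Fin dB, (T.card ^ (fiberL S l).card * n.factorial) ^ dA)
      = (n.factorial ^ dA) ^ dB * T.card ^ (dA * S.card) := by
    simp_rw [mul_pow, ← pow_mul]
    rw [Finset.prod_mul_distrib, Finset.prod_const, Finset.card_univ, Fintype.card_fin, ← pow_mul,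
      Finset.prod_pow_eq_pow_sum, mul_comm, ← Finset.sum_mul, sum_card_fiberL, mul_comm S.card]
  rw [hexp1, hexp2] at hall
  exact hall

/-- **M1 — the single-set FAILURE count**: the configurations in which the fixed set `S ⊆ A` fails
`(γ,δ)`-left-expansion, `|Γ_π(S)| < (1-δ)Δ_A|S|`, number at most
`|Ω| · Σ_{m < (1-δ)Δ_A|S|} C(n_B, m)·(m/n)^{Δ_A|S|}` (sum over the possible neighbourhoods `T = Γ_π(S)`,
grouped by size). [folklore] -/
theorem card_expansionFails_le (S : Finset (Fin dB × Fin n)) (δ : ℝ) (hn : 0 < n) :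
    ((univ.filter fun σ : LiftConfig dA dB n =>
        ((leftNbhd (liftMatrix σ) S).card : ℝ) < (1 - δ) * dA * S.card).card : ℝ)
      ≤ Fintype.card (LiftConfig dA dB n) *
          ∑ m ∈ Finset.range ⌈(1 - δ) * dA * S.card⌉₊,
            ((dA * n).choose m : ℝ) * ((m : ℝ) / n) ^ (dA * S.card) := by
  classical
  set Ω : ℝ := (Fintype.card (LiftConfig dA dB n) : ℝ) with hΩ
  set M : ℕ := ⌈(1 - δ) * dA * S.card⌉₊ with hM
  -- cover by the events `Γ(S) ⊆ T`, `T` of size `< M`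
  set smallT : Finset (Finset (Fin dA × Fin n)) := univ.filter fun T => T.card < M with hsmallT
  have hcover : (univ.filter fun σ : LiftConfig dA dB n =>
        ((leftNbhd (liftMatrix σ) S).card : ℝ) < (1 - δ) * dA * S.card)
      ⊆ smallT.biUnion fun T => univ.filter fun σ : LiftConfig dA dB n => leftNbhd (liftMatrix σ) S ⊆ T := by
    intro σ hσ
    rw [Finset.mem_filter] at hσ
    rw [Finset.mem_biUnion]
    refine ⟨leftNbhd (liftMatrix σ) S, ?_, Finset.mem_filter.2 ⟨Finset.mem_univ _, Finset.Subset.refl _⟩⟩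
    rw [hsmallT, Finset.mem_filter, hM]
    refine ⟨Finset.mem_univ _, ?_⟩
    have h := hσ.2
    by_contra hge
    push Not at hge
    have h2 : ((1 - δ) * dA * S.card : ℝ) ≤ ⌈(1 - δ) * dA * S.card⌉₊ := Nat.le_ceil _
    have h3 : (⌈(1 - δ) * ↑dA * ↑S.card⌉₊ : ℝ) ≤ (leftNbhd (liftMatrix σ) S).card := by exact_mod_cast hge
    linarith
  have hn' : (0 : ℝ) < n := by exact_mod_cast hn
  have hstep : ∀ T ∈ smallT,
      ((univ.filter fun σ : LiftConfig dA dB n => leftNbhd (liftMatrix σ) S ⊆ T).card : ℝ)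
        ≤ Ω * (((T.card : ℝ) / n) ^ (dA * S.card)) := by
    intro T _
    have h := card_nbhdWithin_le (dA := dA) S T
    have h' : (((univ.filter fun σ : LiftConfig dA dB n => leftNbhd (liftMatrix σ) S ⊆ T).card : ℝ))
        * (n : ℝ) ^ (dA * S.card) ≤ Ω * (T.card : ℝ) ^ (dA * S.card) := by
      rw [hΩ]; exact_mod_cast h
    rw [div_pow, ← mul_div_assoc, le_div_iff₀ (pow_pos hn' _)]
    exact h'
  calc ((univ.filter fun σ : LiftConfig dA dB n =>
          ((leftNbhd (liftMatrix σ) S).card : ℝ) < (1 - δ) * dA * S.card).card : ℝ)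
      ≤ ((smallT.biUnion fun T => univ.filter fun σ : LiftConfig dA dB n =>
            leftNbhd (liftMatrix σ) S ⊆ T).card : ℝ) := by exact_mod_cast Finset.card_le_card hcover
    _ ≤ ∑ T ∈ smallT, ((univ.filter fun σ : LiftConfig dA dB n => leftNbhd (liftMatrix σ) S ⊆ T).card : ℝ) := by
        exact_mod_cast Finset.card_biUnion_le
    _ ≤ ∑ T ∈ smallT, Ω * (((T.card : ℝ) / n) ^ (dA * S.card)) := Finset.sum_le_sum hstep
    _ = ∑ m ∈ Finset.range M, ∑ T ∈ (univ : Finset (Fin dA × Fin n)).powersetCard m,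
          Ω * (((T.card : ℝ) / n) ^ (dA * S.card)) := by
        rw [hsmallT]
        have hdecomp : (univ.filter fun T : Finset (Fin dA × Fin n) => T.card < M)
            = (Finset.range M).biUnion fun m => (univ : Finset (Fin dA × Fin n)).powersetCard m := by
          ext T
          simp [Finset.mem_powersetCard]
        rw [hdecomp, Finset.sum_biUnion]
        intro m _ m' _ hmm
        simp only [Function.onFun]
        rw [Finset.disjoint_left]
        intro T hT hT'
        rw [Finset.mem_powersetCard] at hT hT'
        exact hmm (hT.2.symm.trans hT'.2)
    _ = ∑ m ∈ Finset.range M, (((dA * n).choose m : ℕ) : ℝ) * (Ω * (((m : ℝ) / n) ^ (dA * S.card))) := by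
        refine Finset.sum_congr rfl fun m _ => ?_
        rw [Finset.sum_congr rfl fun T hT => by rw [(Finset.mem_powersetCard.1 hT).2], Finset.sum_const,
          nsmul_eq_mul, Finset.card_powersetCard, Finset.card_univ, Fintype.card_prod, Fintype.card_fin,
          Fintype.card_fin]
    _ = Ω * ∑ m ∈ Finset.range M, (((dA * n).choose m : ℕ) : ℝ) * ((m : ℝ) / n) ^ (dA * S.card) := by
        rw [Finset.mul_sum]
        refine Finset.sum_congr rfl fun m _ => ?_
        ring

end SingleSet

end Summit.Ventures.QEC.Expanders
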